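import Summits.AtomisticToContinuum.BoseEinsteinCondensation.Theorems.BECThomsonPrincipleGDTransferLnssAlgebra
import Summits.AtomisticToContinuum.BoseEinsteinCondensation.Theorems.BECThomsonPrincipleGDTransferBareAdmissible
import Summits.AtomisticToContinuum.BoseEinsteinCondensation.Theorems.BECThomsonPrincipleGDTransferSeededDefs

/-!
# Route `BECThomsonPrinciple`, crux `GDTransfer` (stmt-AtomisticToContinuum-9482), line `seeded-continuity`:
# stub `stub_projectedDichotomy`, part A2 — SECTOR CALCULUS of the one-body operators `b_i = e_n(x_i)P_i`, `b_i† = P_i^{(n)}`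

Support file of the registered stub `stub_projectedDichotomy`.  For the crux's mode projections
`Q_S = Π_{i∈S}P_i Π_{i∉S}(1 − P_i)` (`Negative.modeProj`, a `foldr` of cell averages `Negative.cellAvg`) and the two
slot operators of the plain witness pair, on continuous functions (`L > 0`, `n ≠ 0`):
* `Q_S Q_T = [S = T] Q_T` (`modeProj_modeProj`) and `Q_S Π_j = [|S| = j] Q_S` for the cardinality projections
  `Π_j = Σ_{|S|=j} Q_S` (`modeProj_cardSum`);
* a phase in slot `i` passes through `P_j`, `j ≠ i` (`cellAvg_phase_mul_of_ne`), and `P_i` kills `e_n(x_i)·(flat in i)`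
  (`cellAvg_phase_mul_flat`), `P_i^{(n)}` kills functions flat in slot `i` (`fourierAvg_flat`);
* **`b_i` LOWERS the sector by `i`**: `Q_S (e_n(x_i)P_i g) = [i ∉ S]·e_n(x_i)·Q_{S ∪ {i}} g` (`modeProj_upSlot`);
* **`b_i†` RAISES the sector by `i`**: `Q_S (P_i^{(n)} g) = [i ∈ S]·P_i^{(n)} Q_{S ∖ {i}} g` (`modeProj_fourierAvg_of_mem`;
  the case `i ∉ S` is the landed `Lnss.modeProj_fourierAvg_eq_zero`);
* hence `B_n Π_j g = Σ_i b_i Π_j g` is supported on cardinality `j − 1` and `B_n† Π_j g` on cardinality `j + 1`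
  (`modeProj_upB_cardSum`, `modeProj_dnB_cardSum`), and functions supported on different cardinalities are orthogonal
  (`integral_conj_mul_eq_zero_of_disjoint_support`).
All [folklore] (LSSY2005 App. A; arXiv:1211.2778 §2).
-/

noncomputable section

open MeasureTheory Filter
open scoped ENNReal NNReal ComplexConjugate

namespace Summit.AtomisticToContinuum.BoseEinsteinCondensation.Cruxes.GDTransfer.Seeded

namespace Sector

open Literature.MathematicalPhysics.QuantumManyBody.BoseGas
open Summit.AtomisticToContinuum.BoseEinsteinCondensation.Theorems.GaussianDominationCan.Negative
open Summit.AtomisticToContinuum.BoseEinsteinCondensation.Cruxes.GDTransfer.DysonDressedWitness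
open ChordVariation (continuous_foldr_cellAvg continuous_modeProj)
open Lnss

variable {N m : ℕ} {L : ℝ}

/-! ## `Q_S Q_T = [S = T] Q_T` -/

/-- The `foldr` of `Q_S` applied to `Q_T g`: the identity if the listed memberships agree, zero otherwise. [folklore] -/
theorem foldr_modeProj_eq (hL : 0 < L) (S T : Finset (Fin N)) (l : List (Fin N)) {g : Config N → ℂ}
    (hg : Continuous g) :
    l.foldr (fun i h => if i ∈ S then cellAvg N L i h else h - cellAvg N L i h) (modeProj N L T g) =
      if ∀ i ∈ l, (i ∈ S ↔ i ∈ T) then modeProj N L T g else 0 := by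
  induction l with
  | nil => simp
  | cons a l ih =>
    rw [List.foldr_cons, ih]
    have hPa := cellAvg_modeProj hL T a hg
    by_cases hl : ∀ i ∈ l, (i ∈ S ↔ i ∈ T)
    · rw [if_pos hl]
      have hcons : (∀ i ∈ a :: l, (i ∈ S ↔ i ∈ T)) ↔ (a ∈ S ↔ a ∈ T) :=
        ⟨fun h => h a List.mem_cons_self, fun h i hi => by
          rcases List.mem_cons.1 hi with rfl | hi
          · exact h
          · exact hl i hi⟩
      by_cases haS : a ∈ S <;> by_cases haT : a ∈ T
      · rw [if_pos haS, hPa, if_pos haT,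
          if_pos (show ∀ i ∈ a :: l, (i ∈ S ↔ i ∈ T) from hcons.2 (iff_of_true haS haT))]
      · rw [if_pos haS, hPa, if_neg haT,
          if_neg (show ¬ ∀ i ∈ a :: l, (i ∈ S ↔ i ∈ T) from fun h => haT ((hcons.1 h).1 haS))]
      · rw [if_neg haS, hPa, if_pos haT, sub_self,
          if_neg (show ¬ ∀ i ∈ a :: l, (i ∈ S ↔ i ∈ T) from fun h => haS ((hcons.1 h).2 haT))]
      · rw [if_neg haS, hPa, if_neg haT, sub_zero,
          if_pos (show ∀ i ∈ a :: l, (i ∈ S ↔ i ∈ T) from hcons.2 (iff_of_false haS haT))]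
    · rw [if_neg hl,
        if_neg (show ¬ ∀ i ∈ a :: l, (i ∈ S ↔ i ∈ T) from
          fun h => hl fun i hi => h i (List.mem_cons_of_mem a hi))]
      by_cases haS : a ∈ S
      · rw [if_pos haS]
        exact cellAvg_zero a
      · rw [if_neg haS, cellAvg_zero, sub_zero]

/-- **`Q_S Q_T g = [S = T] Q_T g`** on continuous `g`. [folklore] -/
theorem modeProj_modeProj (hL : 0 < L) (S T : Finset (Fin N)) {g : Config N → ℂ} (hg : Continuous g) :
    modeProj N L S (modeProj N L T g) = if S = T then modeProj N L T g else 0 := by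
  have h := foldr_modeProj_eq hL S T (List.finRange N) hg
  have hiff : (∀ i ∈ List.finRange N, (i ∈ S ↔ i ∈ T)) ↔ S = T :=
    ⟨fun h' => Finset.ext fun i => h' i (List.mem_finRange i), fun h' i _ => by rw [h']⟩
  by_cases hST : S = T
  · rw [if_pos (hiff.2 hST)] at h
    rw [if_pos hST]
    exact h
  · rw [if_neg (fun h' => hST (hiff.1 h'))] at h
    rw [if_neg hST]
    exact h

/-- **`Q_S Π_j g = [|S| = j] Q_S g`** for the cardinality projection `Π_j = Σ_{|T| = j} Q_T`. [folklore] -/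
theorem modeProj_cardSum (hL : 0 < L) (S : Finset (Fin N)) (j : ℕ) {g : Config N → ℂ} (hg : Continuous g) :
    modeProj N L S (fun X => ∑ T ∈ (Finset.univ : Finset (Finset (Fin N))).filter (fun T => T.card = j),
        modeProj N L T g X) =
      if S.card = j then modeProj N L S g else 0 := by
  rw [modeProj_finset_sum _ (fun T _ => continuous_modeProj T hg)]
  funext X
  simp only [modeProj_modeProj hL _ _ hg, ite_apply, Pi.zero_apply]
  rw [Finset.sum_ite_eq]
  simp only [Finset.mem_filter, Finset.mem_univ, true_and]

/-! ## Phases in one slot versus cell averages -/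

/-- **A phase in slot `i` passes through `P_j`, `j ≠ i`.** [folklore] -/
theorem cellAvg_phase_mul_of_ne {i j : Fin N} (hji : j ≠ i) (n : Fin 3 → ℤ) (h : Config N → ℂ) :
    cellAvg N L j (fun X => cellWave L n (X i) * h X) = fun X => cellWave L n (X i) * cellAvg N L j h X := by
  funext X
  unfold cellAvg
  simp only [Function.update_of_ne hji.symm]
  rw [integral_const_mul, mul_smul_comm]

/-- **`P_i` kills `e_n(x_i)` times a function flat in slot `i`** (`n ≠ 0`). [folklore] -/
theorem cellAvg_phase_mul_flat (hL : 0 < L) {n : Fin 3 → ℤ} (hn : n ≠ 0) (i : Fin N) {h : Config N → ℂ}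
    (hflat : ∀ (X : Config N) (z : Space), h (Function.update X i z) = h X) :
    cellAvg N L i (fun X => cellWave L n (X i) * h X) = 0 := by
  funext X
  rw [Pi.zero_apply]
  unfold cellAvg
  simp only [Function.update_self, hflat]
  rw [integral_mul_const, integral_cell_cellWave_eq_zero hL hn, zero_mul, smul_zero]

/-- **`P_i^{(n)}` kills functions flat in slot `i`** (`n ≠ 0`). [folklore] -/
theorem fourierAvg_flat (hL : 0 < L) {n : Fin 3 → ℤ} (hn : n ≠ 0) (i : Fin (m + 1)) {h : Config (m + 1) → ℂ}
    (hflat : ∀ (X : Config (m + 1)) (z : Space), h (Function.update X i z) = h X) :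
    fourierAvg m L n i h = 0 := by
  funext X
  rw [Pi.zero_apply]
  unfold fourierAvg
  simp only [hflat]
  rw [integral_mul_const, integral_cell_conj_cellWave hL hn, zero_mul, smul_zero]

/-- `P_i^{(n)} 0 = 0`. [folklore] -/
theorem fourierAvg_zero (n : Fin 3 → ℤ) (i : Fin (m + 1)) :
    fourierAvg m L n i (0 : Config (m + 1) → ℂ) = 0 := by
  funext X
  simp [fourierAvg]

/-! ## `b_i = e_n(x_i) P_i` lowers the sector by `i` -/

/-- The `foldr` over a list avoiding `i` commutes with a phase in slot `i`. [folklore] -/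
theorem foldr_phase_mul (S : Finset (Fin N)) (n : Fin 3 → ℤ) (i : Fin N) (l : List (Fin N)) (hl : i ∉ l)
    (h : Config N → ℂ) :
    l.foldr (fun j f => if j ∈ S then cellAvg N L j f else f - cellAvg N L j f)
        (fun X => cellWave L n (X i) * h X) =
      fun X => cellWave L n (X i) *
        l.foldr (fun j f => if j ∈ S then cellAvg N L j f else f - cellAvg N L j f) h X := by
  induction l with
  | nil => rfl
  | cons a l ih =>
    have hai : a ≠ i := fun e => hl (e ▸ List.mem_cons_self)
    have hil : i ∉ l := fun e => hl (List.mem_cons_of_mem a e)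
    rw [List.foldr_cons, List.foldr_cons, ih hil]
    by_cases haS : a ∈ S
    · rw [if_pos haS, if_pos haS]
      exact cellAvg_phase_mul_of_ne hai n _
    · rw [if_neg haS, if_neg haS, cellAvg_phase_mul_of_ne hai n _]
      funext X
      simp only [Pi.sub_apply]
      ring

/-- **`b_i` lowers the sector by `i`**: `Q_S (e_n(x_i) P_i g) = [i ∉ S]·e_n(x_i)·Q_{S ∪ {i}} g` (`n ≠ 0`). [folklore] -/
theorem modeProj_upSlot (hL : 0 < L) {n : Fin 3 → ℤ} (hn : n ≠ 0) (S : Finset (Fin N)) (i : Fin N)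
    {g : Config N → ℂ} (hg : Continuous g) :
    modeProj N L S (fun X => cellWave L n (X i) * cellAvg N L i g X) =
      if i ∈ S then 0 else fun X => cellWave L n (X i) * modeProj N L (insert i S) g X := by
  set l' : List (Fin N) := (List.finRange N).erase i with hl'
  have hperm : (List.finRange N).Perm (i :: l') := List.perm_cons_erase (List.mem_finRange i)
  have hnd : (i :: l').Nodup := hperm.nodup_iff.1 (List.nodup_finRange N)
  have hil' : i ∉ l' := (List.nodup_cons.1 hnd).1
  have hPc : Continuous (cellAvg N L i g) := continuous_cellAvg i hg
  have hφc : Continuous (fun X => cellWave L n (X i) * cellAvg N L i g X) :=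
    ((continuous_cellWave L n).comp (continuous_apply i)).mul hPc
  have e1 : modeProj N L S (fun X => cellWave L n (X i) * cellAvg N L i g X) =
      (i :: l').foldr (fun j f => if j ∈ S then cellAvg N L j f else f - cellAvg N L j f)
        (fun X => cellWave L n (X i) * cellAvg N L i g X) := by
    unfold modeProj
    exact foldr_perm S hperm hφc
  rw [e1, List.foldr_cons, foldr_phase_mul S n i l' hil' (cellAvg N L i g), ← cellAvg_foldr_comm S l' i hg]
  set G : Config N → ℂ := l'.foldr (fun j f => if j ∈ S then cellAvg N L j f else f - cellAvg N L j f) g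
    with hG
  have hflat : ∀ (X : Config N) (z : Space), cellAvg N L i G (Function.update X i z) = cellAvg N L i G X :=
    cellAvg_update i G
  by_cases hiS : i ∈ S
  · rw [if_pos hiS, if_pos hiS]
    exact cellAvg_phase_mul_flat hL hn i hflat
  · rw [if_neg hiS, if_neg hiS, cellAvg_phase_mul_flat hL hn i hflat, sub_zero]
    have e2 : modeProj N L (insert i S) g =
        (i :: l').foldr (fun j f => if j ∈ insert i S then cellAvg N L j f else f - cellAvg N L j f) g := by
      unfold modeProj
      exact foldr_perm (insert i S) hperm hg
    have e3 : l'.foldr (fun j f => if j ∈ insert i S then cellAvg N L j f else f - cellAvg N L j f) g = G :=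
      foldr_congr_set l' (fun j hj => by
        have hji : j ≠ i := fun e => hil' (e ▸ hj)
        simp [Finset.mem_insert, hji]) g
    funext X
    rw [e2, List.foldr_cons, if_pos (Finset.mem_insert_self i S), e3]

/-! ## `b_i† = P_i^{(n)}` raises the sector by `i` -/

/-- **`P_i^{(n)}` commutes with `P_j`, `j ≠ i`**, on continuous functions (`P_i^{(n)} = P_i ∘ e_{-n}(x_i)`). [folklore] -/
theorem fourierAvg_cellAvg_comm {i j : Fin (m + 1)} (hji : j ≠ i) (n : Fin 3 → ℤ) {h : Config (m + 1) → ℂ}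
    (hh : Continuous h) :
    fourierAvg m L n i (cellAvg (m + 1) L j h) = cellAvg (m + 1) L j (fourierAvg m L n i h) := by
  rw [Bare.fourierAvg_eq_cellAvg_phase, Bare.fourierAvg_eq_cellAvg_phase, ← cellAvg_phase_mul_of_ne hji (-n) h]
  exact cellAvg_comm i j (((continuous_cellWave L (-n)).comp (continuous_apply i)).mul hh)

/-- `P_i^{(n)}` through a difference of continuous functions. [folklore] -/
theorem fourierAvg_sub (n : Fin 3 → ℤ) (i : Fin (m + 1)) {f g : Config (m + 1) → ℂ} (hf : Continuous f)
    (hg : Continuous g) :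
    fourierAvg m L n i (f - g) = fourierAvg m L n i f - fourierAvg m L n i g := by
  have hw : Continuous fun X : Config (m + 1) => cellWave L (-n) (X i) :=
    (continuous_cellWave L (-n)).comp (continuous_apply i)
  have hwf : Continuous fun X : Config (m + 1) => cellWave L (-n) (X i) * f X := hw.mul hf
  have hwg : Continuous fun X : Config (m + 1) => cellWave L (-n) (X i) * g X := hw.mul hg
  have h1 : (fun X : Config (m + 1) => cellWave L (-n) (X i) * (f - g) X) =
      (fun X => cellWave L (-n) (X i) * f X) - (fun X => cellWave L (-n) (X i) * g X) := by
    funext X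
    simp only [Pi.sub_apply, mul_sub]
  rw [Bare.fourierAvg_eq_cellAvg_phase, Bare.fourierAvg_eq_cellAvg_phase, Bare.fourierAvg_eq_cellAvg_phase, h1,
    cellAvg_sub i hwf hwg]

/-- The `foldr` over a list avoiding `i` commutes with `P_i^{(n)}`. [folklore] -/
theorem foldr_fourierAvg_comm (S : Finset (Fin (m + 1))) (n : Fin 3 → ℤ) (i : Fin (m + 1)) (l : List (Fin (m + 1)))
    (hl : i ∉ l) {h : Config (m + 1) → ℂ} (hh : Continuous h) :
    l.foldr (fun j f => if j ∈ S then cellAvg (m + 1) L j f else f - cellAvg (m + 1) L j f) (fourierAvg m L n i h) =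
      fourierAvg m L n i
        (l.foldr (fun j f => if j ∈ S then cellAvg (m + 1) L j f else f - cellAvg (m + 1) L j f) h) := by
  induction l with
  | nil => rfl
  | cons a l ih =>
    have hai : a ≠ i := fun e => hl (e ▸ List.mem_cons_self)
    have hil : i ∉ l := fun e => hl (List.mem_cons_of_mem a e)
    have hc := continuous_foldr_cellAvg (L := L) S l hh
    rw [List.foldr_cons, List.foldr_cons, ih hil]
    by_cases haS : a ∈ S
    · rw [if_pos haS, if_pos haS]
      exact (fourierAvg_cellAvg_comm hai n hc).symm
    · rw [if_neg haS, if_neg haS, fourierAvg_sub n i hc (continuous_cellAvg a hc), fourierAvg_cellAvg_comm hai n hc]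

/-- **`b_i†` raises the sector by `i`**: `Q_S (P_i^{(n)} g) = P_i^{(n)} (Q_{S ∖ {i}} g)` for `i ∈ S` (`n ≠ 0`).
[folklore] -/
theorem modeProj_fourierAvg_of_mem (hL : 0 < L) {n : Fin 3 → ℤ} (hn : n ≠ 0) {S : Finset (Fin (m + 1))}
    {i : Fin (m + 1)} (hi : i ∈ S) {g : Config (m + 1) → ℂ} (hg : Continuous g) :
    modeProj (m + 1) L S (fourierAvg m L n i g) = fourierAvg m L n i (modeProj (m + 1) L (S.erase i) g) := by
  set l' : List (Fin (m + 1)) := (List.finRange (m + 1)).erase i with hl'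
  have hperm : (List.finRange (m + 1)).Perm (i :: l') := List.perm_cons_erase (List.mem_finRange i)
  have hnd : (i :: l').Nodup := hperm.nodup_iff.1 (List.nodup_finRange (m + 1))
  have hil' : i ∉ l' := (List.nodup_cons.1 hnd).1
  have hFc : Continuous (fourierAvg m L n i g) := continuous_fourierAvg n i hg
  set G : Config (m + 1) → ℂ :=
    l'.foldr (fun j f => if j ∈ S then cellAvg (m + 1) L j f else f - cellAvg (m + 1) L j f) g with hG
  have hGc : Continuous G := continuous_foldr_cellAvg S l' hg
  -- the left-hand side: `P_i P_i^{(n)} G = P_i^{(n)} G`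
  have e1 : modeProj (m + 1) L S (fourierAvg m L n i g) =
      (i :: l').foldr (fun j f => if j ∈ S then cellAvg (m + 1) L j f else f - cellAvg (m + 1) L j f)
        (fourierAvg m L n i g) := by
    unfold modeProj
    exact foldr_perm S hperm hFc
  rw [e1, List.foldr_cons, foldr_fourierAvg_comm S n i l' hil' hg, if_pos hi,
    cellAvg_eq_self_of_update hL (fourierAvg_update n i G)]
  -- the right-hand side: `P_i^{(n)} (G - P_i G) = P_i^{(n)} G`
  have e2 : modeProj (m + 1) L (S.erase i) g =
      (i :: l').foldr (fun j f => if j ∈ S.erase i then cellAvg (m + 1) L j f else f - cellAvg (m + 1) L j f) g := by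
    unfold modeProj
    exact foldr_perm (S.erase i) hperm hg
  have e3 : l'.foldr (fun j f => if j ∈ S.erase i then cellAvg (m + 1) L j f else f - cellAvg (m + 1) L j f) g =
      G :=
    foldr_congr_set l' (fun j hj => by
      have hji : j ≠ i := fun e => hil' (e ▸ hj)
      simp [Finset.mem_erase, hji]) g
  rw [e2, List.foldr_cons, if_neg (Finset.notMem_erase i S), e3, fourierAvg_sub n i hGc (continuous_cellAvg i hGc),
    fourierAvg_flat hL hn i (cellAvg_update i G), sub_zero]

/-! ## `B_n`, `B_n†` on the cardinality projections; orthogonality across cardinalities -/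

/-- **`B_n Π_j g` is supported on cardinality `j − 1`**: `Q_S (Σ_i e_n(x_i)P_i Π_j g) = 0` unless `|S| + 1 = j`.
[folklore] -/
theorem modeProj_upB_cardSum (hL : 0 < L) {n : Fin 3 → ℤ} (hn : n ≠ 0) (j : ℕ) {S : Finset (Fin N)}
    (hS : S.card + 1 ≠ j) {g : Config N → ℂ} (hg : Continuous g) :
    modeProj N L S (fun X => ∑ i : Fin N, cellWave L n (X i) *
        cellAvg N L i (fun Y => ∑ T ∈ (Finset.univ : Finset (Finset (Fin N))).filter (fun T => T.card = j),
          modeProj N L T g Y) X) = 0 := by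
  have hPic : Continuous (fun Y => ∑ T ∈ (Finset.univ : Finset (Finset (Fin N))).filter (fun T => T.card = j),
      modeProj N L T g Y) := continuous_finsetSum _ fun T _ => continuous_modeProj T hg
  have hbc : ∀ i ∈ (Finset.univ : Finset (Fin N)), Continuous (fun X : Config N => cellWave L n (X i) *
      cellAvg N L i (fun Y => ∑ T ∈ (Finset.univ : Finset (Finset (Fin N))).filter (fun T => T.card = j),
        modeProj N L T g Y) X) := fun i _ =>
    ((continuous_cellWave L n).comp (continuous_apply i)).mul (continuous_cellAvg i hPic)
  rw [modeProj_finset_sum _ hbc]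
  funext X
  rw [Pi.zero_apply]
  refine Finset.sum_eq_zero fun i _ => ?_
  rw [modeProj_upSlot hL hn S i hPic]
  by_cases hiS : i ∈ S
  · rw [if_pos hiS, Pi.zero_apply]
  · rw [if_neg hiS]
    rw [modeProj_cardSum hL (insert i S) j hg, if_neg (by rw [Finset.card_insert_of_notMem hiS]; exact hS),
      Pi.zero_apply, mul_zero]

/-- **`B_n† Π_j g` is supported on cardinality `j + 1`**: `Q_S (Σ_i P_i^{(n)} Π_j g) = 0` unless `|S| = j + 1`.
[folklore] -/
theorem modeProj_dnB_cardSum (hL : 0 < L) {n : Fin 3 → ℤ} (hn : n ≠ 0) (j : ℕ) {S : Finset (Fin (m + 1))}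
    (hS : S.card ≠ j + 1) {g : Config (m + 1) → ℂ} (hg : Continuous g) :
    modeProj (m + 1) L S (fun X => ∑ i : Fin (m + 1), fourierAvg m L n i
        (fun Y => ∑ T ∈ (Finset.univ : Finset (Finset (Fin (m + 1)))).filter (fun T => T.card = j),
          modeProj (m + 1) L T g Y) X) = 0 := by
  have hPic : Continuous (fun Y => ∑ T ∈ (Finset.univ : Finset (Finset (Fin (m + 1)))).filter
      (fun T => T.card = j), modeProj (m + 1) L T g Y) :=
    continuous_finsetSum _ fun T _ => continuous_modeProj T hg
  rw [modeProj_finset_sum _ (fun i _ => continuous_fourierAvg n i hPic)]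
  funext X
  rw [Pi.zero_apply]
  refine Finset.sum_eq_zero fun i _ => ?_
  by_cases hiS : i ∈ S
  · rw [modeProj_fourierAvg_of_mem hL hn hiS hPic, modeProj_cardSum hL (S.erase i) j hg,
      if_neg (fun h => hS ?_), fourierAvg_zero, Pi.zero_apply]
    rw [Finset.card_erase_of_mem hiS] at h
    have := Finset.card_pos.2 ⟨i, hiS⟩
    omega
  · rw [modeProj_fourierAvg_eq_zero hL n hiS hPic, Pi.zero_apply]

/-- **Functions with disjoint `Q`-supports are orthogonal**: if for every `S` one of `Q_S a`, `Q_S b` vanishes, then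
`∫ conj(a) b = 0` (`b = Σ_S Q_S b`, `Q_S` self-adjoint). [folklore] -/
theorem integral_conj_mul_eq_zero_of_disjoint_support {n : ℕ} {a b : Config (n + 1) → ℂ} (ha : Continuous a)
    (hb : Continuous b)
    (h : ∀ S : Finset (Fin (n + 1)), modeProj (n + 1) L S a = 0 ∨ modeProj (n + 1) L S b = 0) :
    ∫ X in cellN (n + 1) L, conj (a X) * b X = 0 := by
  have hid : ∀ X, b X = ∑ S : Finset (Fin (n + 1)), modeProj (n + 1) L S b X := fun X => by
    have e := congrFun (sum_modeProj (L := L) b) X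
    rw [Finset.sum_apply] at e
    exact e.symm
  have hint : ∀ S ∈ (Finset.univ : Finset (Finset (Fin (n + 1)))),
      Integrable (fun X => conj (a X) * modeProj (n + 1) L S b X)
        ((volume : Measure (Config (n + 1))).restrict (cellN (n + 1) L)) := fun S _ =>
    integrableOn_cellN ((Complex.continuous_conj.comp ha).mul (continuous_modeProj S hb)) L
  calc ∫ X in cellN (n + 1) L, conj (a X) * b X
      = ∫ X in cellN (n + 1) L, ∑ S : Finset (Fin (n + 1)), conj (a X) * modeProj (n + 1) L S b X := by
        refine integral_congr_ae (Eventually.of_forall fun X => ?_)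
        dsimp only
        rw [hid X, Finset.mul_sum]
    _ = ∑ S : Finset (Fin (n + 1)), ∫ X in cellN (n + 1) L, conj (a X) * modeProj (n + 1) L S b X :=
        integral_finsetSum _ hint
    _ = 0 := Finset.sum_eq_zero fun S _ => by
        rcases h S with hS | hS
        · rw [integral_conj_mul_modeProj S ha hb, hS]
          simp
        · rw [hS]
          simp

end Sector

/-- **Part A2 of `stub_projectedDichotomy` (registered helper statement)**: the creator slot operator
`b_i† = P_i^{(n)}` RAISES the condensate sector by `i` — `Q_S (P_i^{(n)} g) = P_i^{(n)} (Q_{S ∖ {i}} g)` for `i ∈ S`,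
`n ≠ 0`, continuous `g`. [folklore] -/
theorem sector_modeProj_fourierAvg_of_mem :
    ∀ (m : ℕ) (L : ℝ), 0 < L → ∀ (n : Fin 3 → ℤ), n ≠ 0 → ∀ (S : Finset (Fin (m + 1))) (i : Fin (m + 1)), i ∈ S →
      ∀ (g : Literature.MathematicalPhysics.QuantumManyBody.BoseGas.Config (m + 1) → ℂ), Continuous g →
        Summit.AtomisticToContinuum.BoseEinsteinCondensation.Theorems.GaussianDominationCan.Negative.modeProj (m + 1) L S
            (Summit.AtomisticToContinuum.BoseEinsteinCondensation.Cruxes.GDTransfer.DysonDressedWitness.fourierAvg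
              m L n i g) =
          Summit.AtomisticToContinuum.BoseEinsteinCondensation.Cruxes.GDTransfer.DysonDressedWitness.fourierAvg m L n i
            (Summit.AtomisticToContinuum.BoseEinsteinCondensation.Theorems.GaussianDominationCan.Negative.modeProj (m + 1)
              L (S.erase i) g) :=
  fun _ _ hL _ hn _ _ hi _ hg => Sector.modeProj_fourierAvg_of_mem hL hn hi hg

end Summit.AtomisticToContinuum.BoseEinsteinCondensation.Cruxes.GDTransfer.Seeded

end
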